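import Summits.ResolutionOfSingularities.ResolutionOfSingularities.Theorems.FrameStep2
import Summits.ResolutionOfSingularities.ResolutionOfSingularities.Theorems.ShallowPort1
import Summits.ResolutionOfSingularities.ResolutionOfSingularities.Theorems.PurelyInseparableDim4MohAlong

/-!
# FrameStep (slice 3/4: frame polynomial, re-centring, chart frames; Steps A–C)

Continuation of `Theorems.FrameStep2` ((M-Dict) TOOL of the `decomp-res` cell, lens-5 g39, toward
`TightDefectClasses.TowerDictionary`; see the module docstring of `Theorems.FrameStep1` for the architecture).

This slice: the frame polynomial `Z^q + F(u)` and its `u_j`-blow-up law; the re-centring substitutions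
`shift`/`unshift` (`u ↦ u ± b`, `Z ↦ Z ± h(u)`) — mutually inverse, compatible with `translate`, and
PRESERVING the frame polynomial through the cleaning `D = translate b G + h^(p^e)` (Frobenius additivity
`sub_pow_char_pow`); the chart frame `chartFrame θ j` (`θ = θ' ∘ blowSubst_j`, injective);
Step A `exists_coordinate_unit` (chart switch: some `θ(X o)/c_j` is a unit of `B'`), Step B
`exists_unit_ratio` (the `Z`-chart is excluded: `θ(Z^q+F) = θ(Z)^q (1 + m)`, `m ∈ 𝔪`), Step C
`exists_centre` (a `K`-rational centre with `b_j = 0`).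
-/

set_option linter.dupNamespace false

open MvPolynomial
open Literature.AlgebraicGeometry.Resolution
open Literature.AlgebraicGeometry.Resolution.Hauser2010
open Literature.AlgebraicGeometry.Resolution.PointBlowup
open Summit.ResolutionOfSingularities.ResolutionOfSingularities.Theorems.ShallowPort

namespace Summit.ResolutionOfSingularities.ResolutionOfSingularities.Theorems.FrameStep

noncomputable section

variable {σ : Type} [Fintype σ] [DecidableEq σ] {K : Type} [Field K]

/-! ## §3 The frame step -/

section Step

variable {L : Type} [Field L] [Algebra K L] {B' : Subring L}

/-- The frame polynomial `Z^q + F(u)` of a residual polynomial `F`.  DEFINITION (support). -/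
def framePoly (q : ℕ) (F : MvPolynomial σ K) : MvPolynomial (Option σ) K := X none ^ q + rename some F

/-- The blow-up substitution of the `u_j`-chart on the frame polynomial:
`Z^q + F ↦ u_j^q · (Z^q + chartTransform F)`. -/
theorem blowSubst_framePoly (j : σ) (q : ℕ) (F : MvPolynomial σ K) (hF : ∀ d ∈ F.support, q ≤ d.degree) :
    blowSubst K (some j) (framePoly q F) = X (some j) ^ q * framePoly q (chartTransform q j F) := by
  rw [framePoly, framePoly, map_add, map_pow, blowSubst_X_of_ne (Option.some_ne_none j).symm,
    blowSubst_rename_eq j q F hF, mul_pow, mul_add]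

-- The translation law `translate_translate` is the tree's `PIDim4.MohAlong.translate_translate`
-- [Theorems/PurelyInseparableDim4MohAlong] — cited, not restated (gate `dedup.landed`;
-- writer deviation, everything else verbatim).

omit [Fintype σ] [DecidableEq σ] in
/-- `translate 0 = id`. -/
theorem translate_zero (Q : MvPolynomial σ K) : PointBlowup.translate 0 Q = Q := by
  simp [PointBlowup.translate]

omit [Fintype σ] [DecidableEq σ] in
/-- `rename some ∘ translate b` as one substitution. -/
theorem rename_translate (b : σ → K) (Q : MvPolynomial σ K) :
    rename some (PointBlowup.translate b Q)
      = aeval (fun m => (X (some m) + C (b m) : MvPolynomial (Option σ) K)) Q := by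
  rw [PointBlowup.translate, comp_aeval_apply]
  refine congrArg (fun f : σ → MvPolynomial (Option σ) K => aeval f Q) (funext fun m => ?_)
  simp only [map_add, rename_X, rename_C]

/-- Values of the re-centring substitution.  DEFINITION (support). -/
def shiftVal (b : σ → K) (h : MvPolynomial σ K) : Option σ → MvPolynomial (Option σ) K
  | none => X none + rename some h
  | some m => X (some m) + C (b m)

/-- The re-centring substitution `u_m ↦ u_m + b_m`, `Z ↦ Z + h(u)` of `K[Z,u]`.  DEFINITION (support). -/
def shift (b : σ → K) (h : MvPolynomial σ K) : MvPolynomial (Option σ) K →ₐ[K] MvPolynomial (Option σ) K :=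
  aeval (shiftVal b h)

/-- Values of the inverse re-centring.  DEFINITION (support). -/
def unshiftVal (b : σ → K) (h : MvPolynomial σ K) : Option σ → MvPolynomial (Option σ) K
  | none => X none - rename some (PointBlowup.translate (-b) h)
  | some m => X (some m) - C (b m)

/-- The inverse re-centring `u_m ↦ u_m − b_m`, `Z ↦ Z − h(u − b)`.  DEFINITION (support). -/
def unshift (b : σ → K) (h : MvPolynomial σ K) : MvPolynomial (Option σ) K →ₐ[K] MvPolynomial (Option σ) K :=
  aeval (unshiftVal b h)

omit [Fintype σ] [DecidableEq σ] in
/-- Value of `shift` on `Z`. -/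
theorem shift_X_none (b : σ → K) (h : MvPolynomial σ K) : shift b h (X none) = X none + rename some h :=
  aeval_X _ _

omit [Fintype σ] [DecidableEq σ] in
/-- Value of `shift` on `u_m`. -/
theorem shift_X_some (b : σ → K) (h : MvPolynomial σ K) (m : σ) : shift b h (X (some m)) = X (some m) + C (b m) :=
  aeval_X _ _

omit [Fintype σ] [DecidableEq σ] in
/-- Value of `unshift` on `Z`. -/
theorem unshift_X_none (b : σ → K) (h : MvPolynomial σ K) :
    unshift b h (X none) = X none - rename some (PointBlowup.translate (-b) h) :=
  aeval_X _ _

omit [Fintype σ] [DecidableEq σ] in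
/-- Value of `unshift` on `u_m`. -/
theorem unshift_X_some (b : σ → K) (h : MvPolynomial σ K) (m : σ) :
    unshift b h (X (some m)) = X (some m) - C (b m) :=
  aeval_X _ _

omit [Fintype σ] [DecidableEq σ] in
/-- `shift` on `rename some Q` is `translate b`. -/
theorem shift_rename (b : σ → K) (h Q : MvPolynomial σ K) :
    shift b h (rename some Q) = rename some (PointBlowup.translate b Q) := by
  rw [shift, aeval_rename, rename_translate b Q]
  rfl

omit [Fintype σ] [DecidableEq σ] in
/-- `unshift` on `rename some Q` is `translate (−b)`. -/
theorem unshift_rename (b : σ → K) (h Q : MvPolynomial σ K) :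
    unshift b h (rename some Q) = rename some (PointBlowup.translate (-b) Q) := by
  rw [unshift, aeval_rename, rename_translate (-b) Q]
  refine congrArg (fun f : σ → MvPolynomial (Option σ) K => aeval f Q) (funext fun m => ?_)
  simp [unshiftVal, sub_eq_add_neg]

omit [Fintype σ] [DecidableEq σ] in
/-- `shift ∘ unshift = id`. -/
theorem shift_comp_unshift (b : σ → K) (h : MvPolynomial σ K) :
    (shift b h).comp (unshift b h) = AlgHom.id K _ := by
  refine MvPolynomial.algHom_ext fun o => ?_
  rcases o with _ | m
  · rw [AlgHom.comp_apply, AlgHom.id_apply, unshift_X_none, map_sub, shift_X_none, shift_rename,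
      PIDim4.MohAlong.translate_translate, add_neg_cancel, translate_zero]
    exact add_sub_cancel_right _ _
  · rw [AlgHom.comp_apply, AlgHom.id_apply, unshift_X_some, map_sub, shift_X_some, algHom_C,
      MvPolynomial.algebraMap_eq]
    exact add_sub_cancel_right _ _

omit [Fintype σ] [DecidableEq σ] in
/-- `unshift ∘ shift = id`. -/
theorem unshift_comp_shift (b : σ → K) (h : MvPolynomial σ K) :
    (unshift b h).comp (shift b h) = AlgHom.id K _ := by
  refine MvPolynomial.algHom_ext fun o => ?_
  rcases o with _ | m
  · rw [AlgHom.comp_apply, AlgHom.id_apply, shift_X_none, map_add, unshift_X_none, unshift_rename]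
    exact sub_add_cancel _ _
  · rw [AlgHom.comp_apply, AlgHom.id_apply, shift_X_some, map_add, unshift_X_some, algHom_C,
      MvPolynomial.algebraMap_eq]
    exact sub_add_cancel _ _

omit [Fintype σ] [DecidableEq σ] in
/-- `unshift (shift P) = P`. -/
theorem unshift_shift (b : σ → K) (h : MvPolynomial σ K) (P : MvPolynomial (Option σ) K) :
    unshift b h (shift b h P) = P := by
  have := DFunLike.congr_fun (unshift_comp_shift b h) P
  simpa using this

omit [Fintype σ] [DecidableEq σ] in
/-- `unshift` is injective. -/
theorem unshift_injective (b : σ → K) (h : MvPolynomial σ K) : Function.Injective (unshift b h) := by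
  intro x y hxy
  have := congrArg (shift b h) hxy
  rwa [← AlgHom.comp_apply, ← AlgHom.comp_apply, shift_comp_unshift, AlgHom.id_apply, AlgHom.id_apply] at this

omit [Fintype σ] [DecidableEq σ] in
/-- **Re-centring and cleaning preserve the frame polynomial** (Frobenius additivity):
if `D = translate b G + h^{p^e}` then `θ'(unshift (Z^{p^e} + D)) = θ'(Z^{p^e} + G)`. -/
theorem comp_unshift_framePoly (p : ℕ) [Fact p.Prime] [CharP K p] (e : ℕ)
    (θ' : MvPolynomial (Option σ) K →ₐ[K] L) (b : σ → K) (h G D : MvPolynomial σ K)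
    (hD : PointBlowup.translate b G + h ^ p ^ e = D) :
    (θ'.comp (unshift b h)) (framePoly (p ^ e) D) = θ' (framePoly (p ^ e) G) := by
  haveI : CharP L p := charP_of_injective_algebraMap (algebraMap K L).injective p
  rw [AlgHom.comp_apply, framePoly, framePoly, ← hD]
  simp only [map_add, map_pow, unshift_X_none, unshift_rename, map_sub, PIDim4.MohAlong.translate_translate,
    neg_add_cancel,
    translate_zero]
  rw [sub_pow_char_pow]
  ring

/-- The chart frame `θ'` of the `u_j`-chart: `u_j ↦ θ u_j`, `X o ↦ θ(X o)/θ(u_j)`.  DEFINITION (support). -/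
def chartFrame (θ : MvPolynomial (Option σ) K →ₐ[K] L) (j : σ) : MvPolynomial (Option σ) K →ₐ[K] L :=
  aeval fun o => if o = some j then θ (X (some j)) else θ (X o) / θ (X (some j))

omit [Fintype σ] in
/-- `θ' ∘ blowSubst_j = θ`. -/
theorem chartFrame_comp (θ : MvPolynomial (Option σ) K →ₐ[K] L) (hθ : Function.Injective θ) (j : σ) :
    (chartFrame θ j).comp (blowSubst K (some j)) = θ := by
  have hj : θ (X (some j)) ≠ 0 := (map_ne_zero_iff θ hθ).mpr (X_ne_zero (some j))
  refine MvPolynomial.algHom_ext fun o => ?_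
  by_cases h : o = some j
  · subst h
    rw [AlgHom.comp_apply, blowSubst_X_self, chartFrame, aeval_X, if_pos rfl]
  · rw [AlgHom.comp_apply, blowSubst_X_of_ne h, map_mul, chartFrame, aeval_X, aeval_X, if_pos rfl, if_neg h,
      mul_div_assoc', mul_div_cancel_left₀ _ hj]

omit [Fintype σ] in
/-- Values of the chart frame. -/
theorem chartFrame_X_self (θ : MvPolynomial (Option σ) K →ₐ[K] L) (j : σ) :
    chartFrame θ j (X (some j)) = θ (X (some j)) := by
  rw [chartFrame, aeval_X, if_pos rfl]

omit [Fintype σ] in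
/-- Values of the chart frame. -/
theorem chartFrame_X_of_ne (θ : MvPolynomial (Option σ) K →ₐ[K] L) (j : σ) {o : Option σ} (h : o ≠ some j) :
    chartFrame θ j (X o) = θ (X o) / θ (X (some j)) := by
  rw [chartFrame, aeval_X, if_neg h]

/-- The chart frame is injective. -/
theorem chartFrame_injective (θ : MvPolynomial (Option σ) K →ₐ[K] L) (hθ : Function.Injective θ) (j : σ) :
    Function.Injective (chartFrame θ j) :=
  injective_of_comp_blowSubst (some j) _ (by rw [chartFrame_comp θ hθ j]; exact hθ)

/-! ### Step A: chart switch — one of the `θ(X o)/c_j` is a unit of `B'` -/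

omit [DecidableEq σ] in
/-- **Chart switch.** For a point blow-up certificate `B(θ) → B'` along the origin ideal, every
`θ(X o)/c_j` lies in `B'` and one of them is a unit of `B'`. -/
theorem exists_coordinate_unit [IsLocalRing B'] (θ : MvPolynomial (Option σ) K →ₐ[K] L)
    (hθ : Function.Injective θ) (cert : PointBlowupCert (frameRing θ hθ) B' (originIdeal θ hθ)) :
    (∀ o, θ (X o) / ((cert.c cert.j : frameRing θ hθ) : L) ∈ B') ∧
      ∃ o₀, θ (X o₀) / ((cert.c cert.j : frameRing θ hθ) : L) ∈ unitSet B' := by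
  have hBB' : frameRing θ hθ ≤ B' := le_trans (fun x hx => Subring.subset_closure (Or.inl hx)) cert.le
  have hc0 : ((cert.c cert.j : frameRing θ hθ) : L) ≠ 0 := fun h => cert.ne_zero (Subtype.ext h)
  have hquot : ∀ l, ((cert.c l : frameRing θ hθ) : L) / ((cert.c cert.j : frameRing θ hθ) : L) ∈ B' :=
    fun l => cert.le (Subring.subset_closure (Or.inr ⟨cert.c l, ⟨l, rfl⟩, rfl⟩))
  have hdiv : ∀ o, θ (X o) / ((cert.c cert.j : frameRing θ hθ) : L) ∈ B' := by
    intro o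
    have ho : (⟨θ (X o), map_mem_frameRing θ hθ (X o)⟩ : frameRing θ hθ) ∈ Ideal.span (Set.range cert.c) := by
      rw [cert.span_eq]
      exact Ideal.subset_span ⟨o, rfl⟩
    obtain ⟨r, hr⟩ := Ideal.mem_span_range_iff_exists_fun.mp ho
    have hval : θ (X o) = ∑ l, ((r l : frameRing θ hθ) : L) * ((cert.c l : frameRing θ hθ) : L) := by
      have := congrArg Subtype.val hr
      simpa using this.symm
    rw [hval, Finset.sum_div]
    exact sum_mem fun l _ => by rw [mul_div_assoc]; exact mul_mem (hBB' (r l).2) (hquot l)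
  refine ⟨hdiv, ?_⟩
  have hcj : (cert.c cert.j : frameRing θ hθ) ∈ originIdeal θ hθ := by
    have h0 : cert.c cert.j ∈ Ideal.span (Set.range cert.c) := Ideal.subset_span ⟨cert.j, rfl⟩
    rwa [cert.span_eq] at h0
  obtain ⟨a, ha⟩ := Ideal.mem_span_range_iff_exists_fun.mp hcj
  have hsum : ∑ o, ((a o : frameRing θ hθ) : L) * (θ (X o) / ((cert.c cert.j : frameRing θ hθ) : L)) = 1 := by
    have h1 := congrArg Subtype.val ha
    simp only [AddSubmonoidClass.coe_finsetSum, Subring.coe_mul] at h1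
    simp_rw [mul_div_assoc']
    rw [← Finset.sum_div, h1, div_self hc0]
  by_contra hall
  push Not at hall
  have hmax : ∀ o, θ (X o) / ((cert.c cert.j : frameRing θ hθ) : L) ∈ maxSet B' := fun o =>
    (mem_maxSet_or_mem_unitSet (hdiv o)).resolve_right (hall o)
  have h1 : (1 : L) ∈ maxSet B' := by
    rw [← hsum]
    exact sum_mem_maxSet _ _ fun o _ => mul_mem_maxSet_left (hBB' (a o).2) (hmax o)
  exact one_not_mem_maxSet h1

/-! ### Step B: the `Z`-chart is excluded -/

/-- **The `Z`-chart is excluded.** If the frame is centred in `B'`, `θ(Z^q + F) = c^q · g` with `g ∈ 𝔪_{B'}`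
and some `θ(X o₀)/c` is a unit, then some `θ(u_j)/c` is a unit: were only `θ(Z)/c` a unit, the `Z`-chart
computation `θ(Z^q + F) = θ(Z)^q (1 + m)`, `m ∈ 𝔪_{B'}`, would make `g` a unit. -/
theorem exists_unit_ratio [IsLocalRing B'] (θ : MvPolynomial (Option σ) K →ₐ[K] L)
    (hθ : Function.Injective θ) (hK : ∀ c : K, algebraMap K L c ∈ B') (hloc : ∀ o, θ (X o) ∈ maxSet B')
    (q : ℕ) (hq : 1 ≤ q) (F : MvPolynomial σ K) (hF : ∀ d ∈ F.support, q ≤ d.degree)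
    (c : L) (hc0 : c ≠ 0) (hc : ∀ o, θ (X o) / c ∈ B') (o₀ : Option σ) (ho₀ : θ (X o₀) / c ∈ unitSet B')
    (g : L) (hg : g ∈ maxSet B') (hfg : θ (framePoly q F) = c ^ q * g) :
    ∃ j : σ, θ (X (some j)) / c ∈ unitSet B' := by
  rcases o₀ with _ | j
  swap
  · exact ⟨j, ho₀⟩
  by_contra hnone
  push Not at hnone
  have hZ0 : θ (X none) ≠ 0 := (map_ne_zero_iff θ hθ).mpr (X_ne_zero _)
  have hcZ : c / θ (X none) ∈ B' := by
    have := inv_mem_unitSet ho₀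
    rw [inv_div] at this
    exact this.1
  have hrat : ∀ m : σ, θ (X (some m)) / θ (X none) ∈ maxSet B' := by
    intro m
    have hmem : θ (X (some m)) / θ (X none) = (θ (X (some m)) / c) * (c / θ (X none)) := by
      field_simp
    have hB : θ (X (some m)) / θ (X none) ∈ B' := by
      rw [hmem]
      exact mul_mem (hc _) hcZ
    refine (mem_maxSet_or_mem_unitSet hB).resolve_right fun hu => hnone m ?_
    have he : θ (X (some m)) / c = θ (X (some m)) / θ (X none) * (θ (X none) / c) := by
      field_simp
    rw [he]
    exact mul_mem_unitSet hu ho₀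
  set θZ : MvPolynomial (Option σ) K →ₐ[K] L :=
    aeval fun o => if o = none then θ (X none) else θ (X o) / θ (X none) with hθZ_def
  have hθZZ : θZ (X none) = θ (X none) := by
    rw [hθZ_def, aeval_X, if_pos rfl]
  have hθZm : ∀ m : σ, θZ (X (some m)) = θ (X (some m)) / θ (X none) := fun m => by
    rw [hθZ_def, aeval_X, if_neg (Option.some_ne_none m)]
  have hcomp : θZ.comp (blowSubst K none) = θ := by
    refine MvPolynomial.algHom_ext fun o => ?_
    rcases o with _ | m
    · rw [AlgHom.comp_apply, blowSubst_X_self, hθZZ]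
    · rw [AlgHom.comp_apply, blowSubst_X_of_ne (Option.some_ne_none m), map_mul, hθZZ, hθZm,
        mul_div_assoc', mul_div_cancel_left₀ _ hZ0]
  have hθZvar : ∀ o, θZ (X o) ∈ maxSet B' := by
    intro o
    rcases o with _ | m
    · rw [hθZZ]
      exact hloc none
    · rw [hθZm]
      exact hrat m
  have hval : θ (framePoly q F) = θ (X none) ^ q * (1 + θZ (zChartResidual q F)) := by
    have h1 : θ (framePoly q F) = θZ (blowSubst K none (framePoly q F)) := by
      rw [← AlgHom.comp_apply, hcomp]
    rw [h1, framePoly, map_add, map_pow, blowSubst_X_self, blowSubst_none_rename_eq q F hF, map_add, map_pow,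
      map_mul, map_pow, hθZZ]
    ring
  have hres : θZ (zChartResidual q F) ∈ maxSet B' :=
    eval_mem_maxSet_of_mem θZ hK hθZvar (zChartResidual_mem q hq F hF)
  have hunit : 1 + θZ (zChartResidual q F) ∈ unitSet B' := add_mem_unitSet_of_mem_maxSet one_mem_unitSet hres
  have hgeq : g = (θ (X none) / c) ^ q * (1 + θZ (zChartResidual q F)) := by
    have hcq : c ^ q ≠ 0 := pow_ne_zero _ hc0
    rw [div_pow, div_mul_eq_mul_div, eq_div_iff hcq, ← hval, hfg, mul_comm]
  exact not_mem_maxSet_of_mem_unitSet (hgeq ▸ mul_mem_unitSet (pow_mem_unitSet q ho₀) hunit) hg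

/-! ### Step C: the centre of the new frame -/

omit [Fintype σ] in
/-- **`K`-rational centre.** If the residue field of `B'` is `K` (every element is a constant modulo `𝔪`),
the chart frame has a centre `b` with `b_j = 0` and `θ'(u_m) - b_m ∈ 𝔪_{B'}`. -/
theorem exists_centre [IsLocalRing B'] (hrat : ∀ w ∈ B', ∃ c : K, w - algebraMap K L c ∈ maxSet B')
    (θ' : MvPolynomial (Option σ) K →ₐ[K] L) (hθ'B : ∀ o, θ' (X o) ∈ B') (j : σ)
    (hj : θ' (X (some j)) ∈ maxSet B') :
    ∃ b : σ → K, b j = 0 ∧ ∀ m, θ' (X (some m)) - algebraMap K L (b m) ∈ maxSet B' := by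
  classical
  refine ⟨fun m => if m = j then 0 else Classical.choose (hrat _ (hθ'B (some m))), by simp, fun m => ?_⟩
  by_cases hm : m = j
  · subst hm
    simpa using hj
  · simp only [if_neg hm]
    exact Classical.choose_spec (hrat _ (hθ'B (some m)))

end Step

end

end Summit.ResolutionOfSingularities.ResolutionOfSingularities.Theorems.FrameStep
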